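import Literature.NumberTheory.GaloisRepresentations.SemiLocalCompositumBridge
import Literature.NumberTheory.GaloisRepresentations.LocalExistenceTheoremProofs
import Literature.NumberTheory.GaloisRepresentations.InertiaRootsOfUnity
import Mathlib.FieldTheory.Galois.Infinite
import HarnessLib

/-!
# The distinguished place `w_v ∣ v` cut out by `K̄ → K̄_v`, and the `K_v`-embedding `E_{w_v} → K̄_v`
# extending `ι_v ∘ ιE` (Cassels–Fröhlich II §10, VII §1.1; Neukirch II (8.1)–(8.3); Harari §13.1)

Topic `NumberTheory/GaloisRepresentations`; namespace `Literature.NumberTheory.GaloisRepresentations.SemiLocal`.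
Definitions with bodies (a CHOICE from the tree's existence theorem `exists_place_algHom_compositum`, then
derived maps) and theorems; NO named fact, no `sorry`, no instance, no notation; number fields in one universe
(`Type`, as in `SemiLocalCompositumBridge.lean`).

Why (Route A of crux `AnticycControlAdditiveK`, item 19295, the idèle side of door-c6 g16's presentation road,
FINDING-door-c6-g16 §5 (R-def)).  The readout of an equivariant homomorphism `N₁ → J̄` at a place `v` of the base
field `K` and the assembly of such a homomorphism from local data (`Hom_G(N₁, J_E) = ∏'_v Hom_{D_w}(N₁, E_wˣ)`)
both need, for every finite Galois layer `E/K` with a `K`-embedding `ιE : E → K̄`, ONE place `w_v ∣ v` of `E`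
together with a `K_v`-algebra embedding `E_{w_v} → K̄_v` of the completion which extends the chosen embedding
`ι_v ∘ ιE : E → K̄ → K̄_v` (`ι_v = absClosureEmbedding K K_v`).  Classically (Neukirch II (8.1)–(8.3),
Cassels–Fröhlich II §10 "`L_w = K_v L`"): the embedding `ι_v ∘ ιE` defines a place `w_v` of `E` above `v`, the
closure of its image is the compositum `K_v(ι_v ιE E) ≅ E_{w_v}`, and `Γ_{K_v}` acts on it through the
decomposition group `G_{w_v}`.  The tree proved the existence statement (`exists_place_algHom_compositum`:
`∃ w₀, ∃ θ : K_v(E) →ₐ[K_v] E_{w₀}`, `θ(ι_v ιE e) = e`, bijective) and its equivariance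
(`algHom_compositum_smul`, `smul_place_eq`, `exists_restrict_eq_of_smul_place_eq`); this file NAMES the choice and
packages it as the embedding `placeEmb v ιE : E_{w_v} →ₐ[K_v] K̄_v`, proves that the pair `(w_v, placeEmb)` is
UNIQUE (rigidity: a `K_v`-algebra map `E_w → K̄_v` extending `ι_v ∘ ιE` forces `w = w_v` and equals `placeEmb`),
and transports the unit group: `u ∈ 𝒪_{w_v}ˣ ↔ t(placeEmb u) = 0` for door-c6's `t = ord_{K_v} ∘ N_{K_v(E)/K_v}`.

## What is formalised (`K E : Type` number fields, `[IsGalois K E]`, `ιE : E →ₐ[K] K̄`, `v` a finite place of `K`)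

* §1 **`embPlace v ιE : Place K E v`** (the place `w_v`), **`compositumEquivEmb v ιE : compositum ιE v ≃ₐ[K_v] E_{w_v}`**
  with `compositumEquivEmb_apply_mk` (`θ(ι_v ιE e) = e`), **`placeEmb v ιE : E_{w_v} →ₐ[K_v] K̄_v`** with
  **`placeEmb_algebraMap`** (`placeEmb e = ι_v (ιE e)`), `placeEmb_mem_compositum`, `placeEmb_injective`,
  `placeEmb_compositumEquivEmb`, `compositumEquivEmb_placeEmb`, `exists_placeEmb_eq_of_mem`.
* §2 rigidity: **`eq_embPlace_of_algHom`** (a `K_v`-algebra map `E_w → K̄_v` extending `ι_v ∘ ιE` forces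
  `w = w_v`), **`algHom_eq_placeEmb`** (and then it is `placeEmb`).
* §3 equivariance: **`smul_embPlace_eq`** (the restriction `g ∈ Gal(E/K)` of `d ∈ Γ_{K_v}` fixes `w_v`),
  **`placeEmb_galAdicCompletionMap`** (`placeEmb (g_{w_v} y) = d • placeEmb y`), `exists_restrict_of_mem_stabilizer`
  (`Γ_{K_v} → G_{w_v}` is onto), `smul_placeEmb_of_restrict_eq_one` (the kernel fixes the image).
* §4 units: **`tVal_placeEmb_eq_zero_iff`** (`t(placeEmb u) = 0 ↔ u ∈ 𝒪_{w_v}ˣ`).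

## References
* J. W. S. Cassels, A. Fröhlich (eds.), *Algebraic Number Theory* (1967), Ch. II (Cassels) §10, Ch. VII (Tate)
  §1.1, Prop. 1.2. [CasselsFrohlichANT1967]
* J. Neukirch, *Algebraic Number Theory* (1999), Ch. II (8.1)–(8.3). [NeukirchANT1999]
* D. Harari, *Galois Cohomology and Class Field Theory* (2020), §13.1 (`K_v := i_v(K) k_v`). [Harari2020]
-/

noncomputable section

open NumberField IsDedekindDomain Field
open Literature.NumberTheory.Automorphic

namespace Literature.NumberTheory.GaloisRepresentations

namespace SemiLocal

variable {K : Type} [Field K] [NumberField K] {E : Type} [Field E] [NumberField E] [Algebra K E]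
variable (v : HeightOneSpectrum (𝓞 K)) [IsGalois K E] (ιE : E →ₐ[K] AlgebraicClosure K)

/-! ## §1. The distinguished place and the embedding `E_{w_v} → K̄_v` -/

/-- **The place `w_v ∣ v` of `E` cut out by the embedding `ι_v ∘ ιE : E → K̄_v`** (the place `w₀` of the tree's
`exists_place_algHom_compositum`: the factor of `E ⊗_K K_v ≅ ∏_{w∣v} E_w` through which `e ⊗ x ↦ ι_v(ιE e) x`
factors). [cite: CasselsFrohlichANT1967, Ch. II §10] [cite: NeukirchANT1999, Ch. II (8.1)] -/
def embPlace : Place K E v :=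
  Classical.choose (exists_place_algHom_compositum v ιE)

/-- The chosen `K_v`-algebra map `θ : K_v(E) → E_{w_v}` with `θ(ι_v ιE e) = e` (auxiliary; packaged as the
isomorphism `compositumEquivEmb`). [cite: CasselsFrohlichANT1967, Ch. II §10] -/
def compositumHomEmb :
    compositum ιE v →ₐ[v.adicCompletion K] ((embPlace v ιE : HeightOneSpectrum (𝓞 E)).adicCompletion E) :=
  Classical.choose (Classical.choose_spec (exists_place_algHom_compositum v ιE))

/-- `θ(ι_v ιE e) = e`. [cite: CasselsFrohlichANT1967, Ch. II §10] -/
theorem compositumHomEmb_apply_mk (e : E) :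
    compositumHomEmb v ιE ⟨(absClosureEmbedding K (v.adicCompletion K)).comp ιE e, mem_compositum v ιE e⟩ =
      algebraMap E _ e :=
  Classical.choose_spec (Classical.choose_spec (exists_place_algHom_compositum v ιE)) e

/-- **`K_v(E) ≃ₐ[K_v] E_{w_v}`**, the isomorphism `θ` of the compositum with the completion at the distinguished
place (bijective by `bijective_algHom_compositum`). [cite: CasselsFrohlichANT1967, Ch. II §10] -/
def compositumEquivEmb :
    compositum ιE v ≃ₐ[v.adicCompletion K] ((embPlace v ιE : HeightOneSpectrum (𝓞 E)).adicCompletion E) :=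
  AlgEquiv.ofBijective (compositumHomEmb v ιE)
    (bijective_algHom_compositum v ιE (compositumHomEmb v ιE) (compositumHomEmb_apply_mk v ιE))

/-- `compositumEquivEmb` is `θ`. [cite: CasselsFrohlichANT1967, Ch. II §10] -/
theorem compositumEquivEmb_apply (x : compositum ιE v) :
    compositumEquivEmb v ιE x = compositumHomEmb v ιE x := rfl

/-- **`θ(ι_v ιE e) = e`** for the isomorphism. [cite: CasselsFrohlichANT1967, Ch. II §10] -/
theorem compositumEquivEmb_apply_mk (e : E) :
    compositumEquivEmb v ιE ⟨(absClosureEmbedding K (v.adicCompletion K)).comp ιE e, mem_compositum v ιE e⟩ =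
      algebraMap E _ e :=
  compositumHomEmb_apply_mk v ιE e

/-- **The `K_v`-embedding `E_{w_v} → K̄_v` of the completion at the distinguished place** (`θ⁻¹` followed by the
inclusion of the compositum). [cite: NeukirchANT1999, Ch. II (8.1)–(8.3)] [cite: CasselsFrohlichANT1967, Ch. II §10] -/
def placeEmb :
    ((embPlace v ιE : HeightOneSpectrum (𝓞 E)).adicCompletion E) →ₐ[v.adicCompletion K]
      AlgebraicClosure (v.adicCompletion K) :=
  (compositum ιE v).val.comp ((compositumEquivEmb v ιE).symm : _ →ₐ[v.adicCompletion K] compositum ιE v)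

/-- Unfolding: `placeEmb y = θ⁻¹ y` in `K̄_v`. [cite: CasselsFrohlichANT1967, Ch. II §10] -/
theorem placeEmb_apply (y : (embPlace v ιE : HeightOneSpectrum (𝓞 E)).adicCompletion E) :
    placeEmb v ιE y = ((compositumEquivEmb v ιE).symm y : AlgebraicClosure (v.adicCompletion K)) := rfl

/-- **`placeEmb` extends `ι_v ∘ ιE`**: `placeEmb e = ι_v (ιE e)` for `e ∈ E`. [cite: NeukirchANT1999, Ch. II (8.1)] -/
theorem placeEmb_algebraMap (e : E) :
    placeEmb v ιE (algebraMap E _ e) = absClosureEmbedding K (v.adicCompletion K) (ιE e) := by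
  rw [placeEmb_apply, ← compositumEquivEmb_apply_mk v ιE e, AlgEquiv.symm_apply_apply]
  rfl

/-- `placeEmb e = ι_v (ιE e)` with the coercion `E → E_{w_v}`. [cite: NeukirchANT1999, Ch. II (8.1)] -/
theorem placeEmb_coe (e : E) :
    placeEmb v ιE (e : (embPlace v ιE : HeightOneSpectrum (𝓞 E)).adicCompletion E) =
      absClosureEmbedding K (v.adicCompletion K) (ιE e) :=
  placeEmb_algebraMap v ιE e

/-- The image of `placeEmb` lies in the compositum `K_v(E)`. [cite: CasselsFrohlichANT1967, Ch. II §10] -/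
theorem placeEmb_mem_compositum (y : (embPlace v ιE : HeightOneSpectrum (𝓞 E)).adicCompletion E) :
    placeEmb v ιE y ∈ compositum ιE v :=
  ((compositumEquivEmb v ιE).symm y).2

/-- `placeEmb` is injective. [cite: NeukirchANT1999, Ch. II (8.1)] -/
theorem placeEmb_injective : Function.Injective (placeEmb v ιE) :=
  (placeEmb v ιE).toRingHom.injective

/-- `placeEmb (θ x) = x`. [cite: CasselsFrohlichANT1967, Ch. II §10] -/
theorem placeEmb_compositumEquivEmb (x : compositum ιE v) :
    placeEmb v ιE (compositumEquivEmb v ιE x) = x := by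
  rw [placeEmb_apply, AlgEquiv.symm_apply_apply]

/-- `θ ⟨placeEmb y, _⟩ = y`. [cite: CasselsFrohlichANT1967, Ch. II §10] -/
theorem compositumEquivEmb_placeEmb (y : (embPlace v ιE : HeightOneSpectrum (𝓞 E)).adicCompletion E) :
    compositumEquivEmb v ιE ⟨placeEmb v ιE y, placeEmb_mem_compositum v ιE y⟩ = y := by
  have h : (⟨placeEmb v ιE y, placeEmb_mem_compositum v ιE y⟩ : compositum ιE v) =
      (compositumEquivEmb v ιE).symm y := Subtype.ext rfl
  rw [h, AlgEquiv.apply_symm_apply]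

/-- **The image of `placeEmb` IS the compositum**: every element of `K_v(E)` is `placeEmb y` for a unique `y`.
[cite: CasselsFrohlichANT1967, Ch. II §10] -/
theorem exists_placeEmb_eq_of_mem {x : AlgebraicClosure (v.adicCompletion K)} (hx : x ∈ compositum ιE v) :
    ∃ y, placeEmb v ιE y = x :=
  ⟨compositumEquivEmb v ιE ⟨x, hx⟩, placeEmb_compositumEquivEmb v ιE ⟨x, hx⟩⟩

/-- `range placeEmb = K_v(E)`. [cite: CasselsFrohlichANT1967, Ch. II §10] -/
theorem range_placeEmb : Set.range (placeEmb v ιE) = (compositum ιE v : Set (AlgebraicClosure (v.adicCompletion K))) := by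
  ext x
  constructor
  · rintro ⟨y, rfl⟩
    exact placeEmb_mem_compositum v ιE y
  · intro hx
    exact exists_placeEmb_eq_of_mem v ιE hx

/-! ## §2. Rigidity: `(w_v, placeEmb)` is the unique pair extending `ι_v ∘ ιE` -/

omit [IsGalois K E] in
/-- Two `K_v`-linear maps out of `E_w` agreeing on `E` agree (`E` spans `E_w` over `K_v`, `span_range_coe_eq_top`).
[cite: CasselsFrohlichANT1967, Ch. II §10] -/
theorem linearMap_ext_of_eqOn_coe [IsGalois K E] {w : Place K E v} {M : Type*} [AddCommGroup M]
    [Module (v.adicCompletion K) M]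
    {f g : ((w : HeightOneSpectrum (𝓞 E)).adicCompletion E) →ₗ[v.adicCompletion K] M}
    (h : ∀ e : E, f (algebraMap E _ e) = g (algebraMap E _ e)) : f = g := by
  refine LinearMap.ext_on_range (span_range_coe_eq_top w) fun e => h e

/-- **Rigidity of the place**: if a `K_v`-algebra map `E_w → K̄_v` extends `ι_v ∘ ιE`, then `w = w_v`
(compose with `θ` corestricted to the compositum — its image IS the compositum, being the `K_v`-span of the image
of `E` — and apply `place_eq_of_algHom`). [cite: CasselsFrohlichANT1967, Ch. II §10] [cite: NeukirchANT1999, Ch. II (8.3)] -/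
theorem eq_embPlace_of_algHom {w : Place K E v}
    (φ : ((w : HeightOneSpectrum (𝓞 E)).adicCompletion E) →ₐ[v.adicCompletion K] AlgebraicClosure (v.adicCompletion K))
    (hφ : ∀ e : E, φ (algebraMap E _ e) = absClosureEmbedding K (v.adicCompletion K) (ιE e)) :
    w = embPlace v ιE := by
  -- the image of `φ` lies in the compositum: it is the span of the image of `E`
  have hrange : ∀ y, φ y ∈ compositum ιE v := by
    intro y
    have hy : y ∈ Submodule.span (v.adicCompletion K)
        (Set.range (algebraMap E ((w : HeightOneSpectrum (𝓞 E)).adicCompletion E))) := by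
      rw [span_range_coe_eq_top w]; exact Submodule.mem_top
    refine Submodule.span_induction (p := fun y _ => φ y ∈ compositum ιE v) ?_ ?_ ?_ ?_ hy
    · rintro _ ⟨e, rfl⟩
      rw [hφ]
      exact mem_compositum v ιE e
    · rw [map_zero]; exact zero_mem _
    · intro x y _ _ hx hy
      rw [map_add]; exact add_mem hx hy
    · intro c x _ hx
      rw [map_smul]
      exact Subalgebra.smul_mem (compositum ιE v).toSubalgebra hx c
  -- corestrict and compose with `θ`
  let φ' : ((w : HeightOneSpectrum (𝓞 E)).adicCompletion E) →ₐ[v.adicCompletion K] compositum ιE v :=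
    φ.codRestrict (compositum ιE v).toSubalgebra hrange
  let Θ : ((w : HeightOneSpectrum (𝓞 E)).adicCompletion E) →ₐ[v.adicCompletion K]
      ((embPlace v ιE : HeightOneSpectrum (𝓞 E)).adicCompletion E) :=
    (compositumEquivEmb v ιE : _ →ₐ[v.adicCompletion K] _).comp φ'
  refine place_eq_of_algHom (v := v) Θ fun e => ?_
  change compositumEquivEmb v ιE (φ' (algebraMap E _ e)) = algebraMap E _ e
  have h1 : φ' (algebraMap E _ e) =
      ⟨(absClosureEmbedding K (v.adicCompletion K)).comp ιE e, mem_compositum v ιE e⟩ :=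
    Subtype.ext (hφ e)
  rw [h1, compositumEquivEmb_apply_mk]

/-- **Rigidity of the embedding**: a `K_v`-algebra map `E_{w_v} → K̄_v` extending `ι_v ∘ ιE` is `placeEmb`
(two `K_v`-linear maps agreeing on the spanning set `E`). [cite: CasselsFrohlichANT1967, Ch. II §10] -/
theorem algHom_eq_placeEmb
    (φ : ((embPlace v ιE : HeightOneSpectrum (𝓞 E)).adicCompletion E) →ₐ[v.adicCompletion K]
      AlgebraicClosure (v.adicCompletion K))
    (hφ : ∀ e : E, φ (algebraMap E _ e) = absClosureEmbedding K (v.adicCompletion K) (ιE e)) :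
    φ = placeEmb v ιE := by
  apply AlgHom.toLinearMap_injective
  exact linearMap_ext_of_eqOn_coe v fun e => by
    rw [AlgHom.toLinearMap_apply, AlgHom.toLinearMap_apply, hφ, placeEmb_algebraMap]

/-- Joint form: a place `w ∣ v` with a `K_v`-algebra map `E_w → K̄_v` extending `ι_v ∘ ιE` is `w_v`, and the map is
`placeEmb` after transport along `w = w_v`. [cite: NeukirchANT1999, Ch. II (8.3)] -/
theorem algHom_apply_eq_placeEmb {w : Place K E v}
    (φ : ((w : HeightOneSpectrum (𝓞 E)).adicCompletion E) →ₐ[v.adicCompletion K] AlgebraicClosure (v.adicCompletion K))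
    (hφ : ∀ e : E, φ (algebraMap E _ e) = absClosureEmbedding K (v.adicCompletion K) (ιE e))
    (h : w = embPlace v ιE) (y : (w : HeightOneSpectrum (𝓞 E)).adicCompletion E) :
    φ y = placeEmb v ιE (cast (congrArg (fun w' : Place K E v => (w' : HeightOneSpectrum (𝓞 E)).adicCompletion E) h) y) := by
  subst h
  rw [algHom_eq_placeEmb v ιE φ hφ]
  rfl

/-! ## §3. Equivariance under `Γ_{K_v}` -/

/-- **The restriction `g` of `d ∈ Γ_{K_v}` fixes the distinguished place** (`g ∈ G_{w_v}`; `smul_place_eq` for `θ`).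
[cite: CasselsFrohlichANT1967, Ch. VII §1.1] -/
theorem smul_embPlace_eq {d : absoluteGaloisGroup (v.adicCompletion K)} {g : E ≃ₐ[K] E}
    (hg : ∀ e : E, ιE (g e) = absGaloisRestrict K (v.adicCompletion K) d • ιE e) :
    g • embPlace v ιE = embPlace v ιE :=
  smul_place_eq v ιE (compositumHomEmb v ιE) (compositumHomEmb_apply_mk v ιE) hg

/-- Coerced form: `g • ↑w_v = ↑w_v` in the places of `E`. [cite: CasselsFrohlichANT1967, Ch. VII §1.1] -/
theorem smul_coe_embPlace_eq {d : absoluteGaloisGroup (v.adicCompletion K)} {g : E ≃ₐ[K] E}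
    (hg : ∀ e : E, ιE (g e) = absGaloisRestrict K (v.adicCompletion K) d • ιE e) :
    g • ((embPlace v ιE : Place K E v) : HeightOneSpectrum (𝓞 E)) = (embPlace v ιE : Place K E v) := by
  rw [Place.smul_coe, smul_embPlace_eq v ιE hg]

/-- **Equivariance `θ(d • x) = g_{w_v}(θ x)`** for the isomorphism (`algHom_compositum_smul`).
[cite: CasselsFrohlichANT1967, Ch. VII §1.1] -/
theorem compositumEquivEmb_smul {d : absoluteGaloisGroup (v.adicCompletion K)} {g : E ≃ₐ[K] E}
    (hg : ∀ e : E, ιE (g e) = absGaloisRestrict K (v.adicCompletion K) d • ιE e) (x : compositum ιE v) :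
    compositumEquivEmb v ιE ⟨d • (x : AlgebraicClosure (v.adicCompletion K)), smul_mem_compositum v ιE hg x.2⟩ =
      galAdicCompletionMap g (smul_coe_embPlace_eq v ιE hg) (compositumEquivEmb v ιE x) := by
  rw [compositumEquivEmb_apply, compositumEquivEmb_apply]
  exact algHom_compositum_smul v ιE (compositumHomEmb v ιE) (compositumHomEmb_apply_mk v ιE) hg
    (smul_coe_embPlace_eq v ιE hg) x x.2

/-- **Equivariance of the embedding: `placeEmb (g_{w_v} y) = d • placeEmb y`** for `d ∈ Γ_{K_v}` with restriction
`g ∈ Gal(E/K)` (Tate: "`σ_w` is a `K_v`-isomorphism"; the local Galois group acts on `E_{w_v}` through `G_{w_v}`).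
[cite: CasselsFrohlichANT1967, Ch. VII §1.1] -/
theorem placeEmb_galAdicCompletionMap {d : absoluteGaloisGroup (v.adicCompletion K)} {g : E ≃ₐ[K] E}
    (hg : ∀ e : E, ιE (g e) = absGaloisRestrict K (v.adicCompletion K) d • ιE e)
    (h : g • ((embPlace v ιE : Place K E v) : HeightOneSpectrum (𝓞 E)) = (embPlace v ιE : Place K E v))
    (y : (embPlace v ιE : HeightOneSpectrum (𝓞 E)).adicCompletion E) :
    placeEmb v ιE (galAdicCompletionMap g h y) = d • placeEmb v ιE y := by
  obtain ⟨x, rfl⟩ : ∃ x : compositum ιE v, compositumEquivEmb v ιE x = y :=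
    ⟨(compositumEquivEmb v ιE).symm y, (compositumEquivEmb v ιE).apply_symm_apply y⟩
  rw [placeEmb_compositumEquivEmb, ← compositumEquivEmb_smul v ιE hg x, placeEmb_compositumEquivEmb]

/-- **`Γ_{K_v} → G_{w_v}` is onto**: every `g` fixing `w_v` is the restriction of some `d ∈ Γ_{K_v}`
(`exists_restrict_eq_of_smul_place_eq`). [cite: CasselsFrohlichANT1967, Ch. VII §1.1, Prop. 1.2] -/
theorem exists_restrict_of_smul_embPlace_eq {g : E ≃ₐ[K] E} (hgw : g • embPlace v ιE = embPlace v ιE) :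
    ∃ d : absoluteGaloisGroup (v.adicCompletion K),
      ∀ e : E, ιE (g e) = absGaloisRestrict K (v.adicCompletion K) d • ιE e :=
  exists_restrict_eq_of_smul_place_eq v ιE (compositumHomEmb v ιE) (compositumHomEmb_apply_mk v ιE) hgw

/-- **The kernel of `Γ_{K_v} → Gal(E/K)` fixes the image of `placeEmb` pointwise** (it is `Gal(K̄_v/K_v(E))`).
[cite: CasselsFrohlichANT1967, Ch. VII §1.1] -/
theorem smul_placeEmb_of_restrict_eq_one {d : absoluteGaloisGroup (v.adicCompletion K)}
    (hd : ∀ e : E, ιE e = absGaloisRestrict K (v.adicCompletion K) d • ιE e)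
    (y : (embPlace v ιE : HeightOneSpectrum (𝓞 E)).adicCompletion E) :
    d • placeEmb v ιE y = placeEmb v ιE y := by
  have hg : ∀ e : E, ιE ((1 : E ≃ₐ[K] E) e) = absGaloisRestrict K (v.adicCompletion K) d • ιE e := fun e => hd e
  rw [← placeEmb_galAdicCompletionMap v ιE hg (smul_coe_embPlace_eq v ιE hg) y, galAdicCompletionMap_one]

/-- Conversely, **an element of `K̄_v` fixed by the kernel of `Γ_{K_v} → Gal(E/K)` lies in the image of
`placeEmb`** (`= K_v(E)`): the kernel contains `Gal(K̄_v/K_v(E))` (it fixes `ι_v(ιE E)`), and `K̄_v/K_v` is Galois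
(characteristic `0`), so the fixed field of `Gal(K̄_v/K_v(E))` is `K_v(E)` (Mathlib `InfiniteGalois.fixedField_fixingSubgroup`).
[cite: CasselsFrohlichANT1967, Ch. VII §1.1] -/
theorem exists_placeEmb_eq_of_forall_smul {x : AlgebraicClosure (v.adicCompletion K)}
    (hx : ∀ d : absoluteGaloisGroup (v.adicCompletion K),
      (∀ e : E, absGaloisRestrict K (v.adicCompletion K) d • ιE e = ιE e) → d • x = x) :
    ∃ y, placeEmb v ιE y = x := by
  apply exists_placeEmb_eq_of_mem
  haveI : CharZero (v.adicCompletion K) := charZero_of_injective_algebraMap (algebraMap K _).injective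
  have hfix : ∀ d ∈ (compositum ιE v).fixingSubgroup, d x = x := fun d hd => by
    rw [IntermediateField.mem_fixingSubgroup_iff] at hd
    have h := hx ((absoluteGaloisGroup.toAlgEquiv (v.adicCompletion K)).symm d) fun e => by
      apply (absClosureEmbedding K (v.adicCompletion K)).injective
      change absClosureEmbedding K (v.adicCompletion K) (_ • ιE e) = absClosureEmbedding K (v.adicCompletion K) (ιE e)
      rw [absGaloisRestrict_apply_smul, absoluteGaloisGroup.toAlgEquiv_symm_apply]
      exact hd _ (mem_compositum v ιE e)
    rwa [absoluteGaloisGroup.toAlgEquiv_symm_apply] at h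
  have hmem : x ∈ IntermediateField.fixedField (compositum ιE v).fixingSubgroup := fun d => hfix d d.2
  rwa [InfiniteGalois.fixedField_fixingSubgroup] at hmem

/-! ## §4. Units: `t(placeEmb u) = 0 ↔ u ∈ 𝒪_{w_v}ˣ ↔ ‖placeEmb u‖ = 1` -/

/-- **The units of valuation zero correspond**: for a unit `u` of `E_{w_v}`, door-c6's
`t = ord_{K_v} ∘ N_{K_v(E)/K_v}` vanishes on `θ⁻¹ u ∈ K_v(E)` iff `u ∈ 𝒪_{w_v}ˣ` (`v_w(u) = 1 ↔ v_v(N u) = 1`,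
`valued_norm_eq_one_iff`; the norm is invariant under the isomorphism `θ`). [cite: SerreLocalFields1979, Ch. II §2 Cor. 4] -/
theorem tVal_compositumEquivEmb_symm_eq_zero_iff
    (u : ((embPlace v ιE : HeightOneSpectrum (𝓞 E)).adicCompletion E)ˣ) :
    LocalWeilDatum.tVal (v.adicCompletion K) (compositum ιE v)
        ((compositumEquivEmb v ιE).symm (u : (embPlace v ιE : HeightOneSpectrum (𝓞 E)).adicCompletion E)) = 0 ↔
      u ∈ placeUnitGroup (embPlace v ιE) := by
  haveI := finiteDimensional_place (K := K) (embPlace v ιE)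
  rw [mem_placeUnitGroup_iff, LocalWeilDatum.tVal, Algebra.norm_eq_of_algEquiv,
    LocalWeilDatum.ord_eq_zero_iff _ (Algebra.norm_ne_zero_iff.mpr u.ne_zero),
    (ValuativeRel.isEquiv (ValuativeRel.valuation (v.adicCompletion K))
      (Valued.v : Valuation (v.adicCompletion K) (WithZero (Multiplicative ℤ)))).eq_one_iff_eq_one,
    valued_norm_eq_one_iff]

/-- The same with the element of the compositum written as `⟨placeEmb u, _⟩`. [cite: SerreLocalFields1979, Ch. II §2 Cor. 4] -/
theorem tVal_placeEmb_eq_zero_iff (u : ((embPlace v ιE : HeightOneSpectrum (𝓞 E)).adicCompletion E)ˣ) :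
    LocalWeilDatum.tVal (v.adicCompletion K) (compositum ιE v)
        ⟨placeEmb v ιE (u : (embPlace v ιE : HeightOneSpectrum (𝓞 E)).adicCompletion E),
          placeEmb_mem_compositum v ιE _⟩ = 0 ↔
      u ∈ placeUnitGroup (embPlace v ιE) := by
  rw [← tVal_compositumEquivEmb_symm_eq_zero_iff v ιE u]
  rfl

end SemiLocal

/-! ## §5. `t_L(a) = 0 ↔ ‖a‖ = 1` for a finite layer `L` of a local field (link with the spectral norm) -/

namespace IsNonarchimedeanLocalField

variable (F : Type) [Field F] [ValuativeRel F] [TopologicalSpace F] [IsNonarchimedeanLocalField F]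

/-- For `a ∈ F`: **`‖a‖ = 1` in `F̄` iff `v(a) = 1`** (from the tree's `algNorm_algebraMap_le_one_iff` and
`algNorm_algebraMap_lt_one_iff`). [cite: SerreLocalFields1979, Ch. II §2] -/
theorem algNorm_algebraMap_eq_one_iff {a : F} :
    algNorm F (algebraMap F (AlgebraicClosure F) a) = 1 ↔ ValuativeRel.valuation F a = 1 := by
  constructor
  · intro h
    have h1 := algNorm_algebraMap_le_one_iff.mp h.le
    have h2 : ¬ ValuativeRel.valuation F a < 1 := fun hlt =>
      absurd (algNorm_algebraMap_lt_one_iff.mpr hlt) (by rw [h]; exact lt_irrefl 1)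
    exact le_antisymm h1 (not_lt.mp h2)
  · intro h
    refine le_antisymm (algNorm_algebraMap_le_one_iff.mpr h.le) ?_
    by_contra hlt
    rw [not_le] at hlt
    exact absurd (algNorm_algebraMap_lt_one_iff.mp hlt) (by rw [h]; exact lt_irrefl 1)

/-- **`‖N_{L/F} a‖ = ‖a‖ ^ [L:F]`** in `F̄` for `a` in a finite layer `L ⊆ F̄` (the tree's
`norm_algebraNorm_eq_spectralNorm_pow` read through `algNorm` and `spectralNorm.eq_of_tower`).
[cite: SerreLocalFields1979, Ch. II §2 Cor. 4] -/
theorem algNorm_algebraMap_norm (L : IntermediateField F (AlgebraicClosure F)) [FiniteDimensional F L] (a : L) :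
    algNorm F (algebraMap F (AlgebraicClosure F) (Algebra.norm F a)) =
      algNorm F (a : AlgebraicClosure F) ^ Module.finrank F L := by
  letI := nontriviallyNormedField F
  rw [algNorm_algebraMap, norm_algebraNorm_eq_spectralNorm_pow F L a,
    spectralNorm.eq_of_tower (L := AlgebraicClosure F) a]
  rfl

/-- **`t_L(a) = 0 ↔ ‖a‖ = 1`** for non-zero `a` in a finite layer `L ⊆ F̄`: door-c6's units of valuation zero
(`LocalWeilDatum.tVal`) are the units of the spectral absolute value `algNorm F` (the currency of
`HomDual.exists_algNorm_eq_one_of_unramified`). [cite: SerreLocalFields1979, Ch. II §2 Cor. 4] -/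
theorem tVal_eq_zero_iff_algNorm_eq_one (L : IntermediateField F (AlgebraicClosure F)) [FiniteDimensional F L]
    {a : L} (ha : a ≠ 0) :
    LocalWeilDatum.tVal F L a = 0 ↔ algNorm F (a : AlgebraicClosure F) = 1 := by
  rw [LocalWeilDatum.tVal, LocalWeilDatum.ord_eq_zero_iff _ (Algebra.norm_ne_zero_iff.mpr ha),
    ← algNorm_algebraMap_eq_one_iff, algNorm_algebraMap_norm]
  exact pow_eq_one_iff_of_nonneg (algNorm_nonneg _) Module.finrank_pos.ne'

end IsNonarchimedeanLocalField

namespace SemiLocal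

variable {K : Type} [Field K] [NumberField K] {E : Type} [Field E] [NumberField E] [Algebra K E]
variable (v : HeightOneSpectrum (𝓞 K)) [IsGalois K E] (ιE : E →ₐ[K] AlgebraicClosure K)

/-- **`u ∈ 𝒪_{w_v}ˣ ↔ ‖placeEmb u‖ = 1`**: the local units at the distinguished place are exactly the elements whose
image in `K̄_v` has spectral absolute value `1` — the unit condition of the presentation road
(`HomDual.exists_algNorm_eq_one_of_unramified`) in the currency of the idèle `J_E`.
[cite: SerreLocalFields1979, Ch. II §2 Cor. 4] [cite: CasselsFrohlichANT1967, Ch. VII §1.1] -/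
theorem mem_placeUnitGroup_iff_algNorm_placeEmb
    (u : ((embPlace v ιE : HeightOneSpectrum (𝓞 E)).adicCompletion E)ˣ) :
    u ∈ placeUnitGroup (embPlace v ιE) ↔
      IsNonarchimedeanLocalField.algNorm (v.adicCompletion K)
        (placeEmb v ιE (u : (embPlace v ιE : HeightOneSpectrum (𝓞 E)).adicCompletion E)) = 1 := by
  haveI := finiteDimensional_place (K := K) (embPlace v ιE)
  haveI : FiniteDimensional (v.adicCompletion K) (compositum ιE v) :=
    LinearEquiv.finiteDimensional (compositumEquivEmb v ιE).symm.toLinearEquiv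
  have hne : (⟨placeEmb v ιE (u : (embPlace v ιE : HeightOneSpectrum (𝓞 E)).adicCompletion E),
      placeEmb_mem_compositum v ιE _⟩ : compositum ιE v) ≠ 0 := fun h => by
    have h' := congrArg Subtype.val h
    exact u.ne_zero (placeEmb_injective v ιE (h'.trans (map_zero (placeEmb v ιE)).symm))
  rw [← tVal_placeEmb_eq_zero_iff, IsNonarchimedeanLocalField.tVal_eq_zero_iff_algNorm_eq_one _ _ hne]

end SemiLocal

end Literature.NumberTheory.GaloisRepresentations

end
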